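import Summits.NavierStokesRegularity.NavierStokesRegularity.Theorems.ScenarioCensusScalingSpectrum
import Summits.NavierStokesRegularity.NavierStokesRegularity.Theorems.ScenarioCensusRotationOrderAxis
import HarnessLib

/-!
# LINE «scaling-spectrum» port, part 2/3: the CENTRE reading — DSS about two distinct centres, `Row_D2cT` PROVED

Re-homed for the scenario census (typer seat ns-census-typer-1 g7; the cells are MEMBERS OF RECORD «DECIDED IN KERNEL IN FILES» of rows D7 / R4
since census v1.68 (lead g9; critic idea-crit-3 PASS + RE-STAMP 19:11:46Z; ref ns-census-ref g8 PRE-CHECK ✓ §13.14 [1/6]; lit §21.20); this port makes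
them TREE-decided): VERBATIM PORT of ns-idea-2 LINE g11-1 «scaling-spectrum» REV 2, `pub/ideators/ns-idea-2/lines/scaling-spectrum/line-scaling-spectrum.lean`
sha16 ae596ee6747cac4b (756 l., lean check rc 0, 0 sorry), split for the 400-line rule into `ScenarioCensusScalingSpectrum` (the log-scaling group, rows
`Row_DdenseT` / `Row_DbiT` / `Row_DncT` + `_holds`, `row_DbiT_of_row_DncT`, the lattice-spectrum display) → `…ScalingSpectrumCentre` (DSS about two centres:
`Row_D2cT` + `_holds`, `atMostOneCentre_of_nontrivial`) → `…ScalingSpectrumRotated` (REV 2: rotated DSS `Row_R2cT`, the apex `Row_DapT` + `_holds`; census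
KEYS).  Lean text VERBATIM in namespace `…Theorems.ScenarioCensus.ScalingSpectrum` (the line's `…Lines.ScalingSpectrum` re-homed); port edits: `local notation
"E3"` → `abbrev E3`, `[folklore]` dropped from the docstrings of the six parameterless row `def`s (gate relocation rule), fourteen one-line docstrings added, lemmas that restate already-landed tree declarations taken BY NAME (gate lint `dedup.landed`): `not_cyclic_of_irrational` = `RotationOrder.not_cyclic_of_irrational`, `rotZ_neg_rotZ` = `RotationOrder.rotZ_neg_rotZ`, `rotZ_rotZ_neg` = `RotationOrder.rotZ_rotZ_neg`, `rotZ_add_vec` = `ScrewBlowdown.rotZ_add_vec`, `rotZ_neg_vec` = `RotationOrder.rotZ_neg_vec`, `rotZ_sub_vec` = `ScrewBlowdown.rotZ_sub_vec`, `rotZ_comm` = `RotationOrder.rotZ_comm`;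
REV 2's «copies of the rotation-order helpers» are not re-declared where the tree already has them (gate lint `dedup.landed`): taken BY NAME from
`…ScenarioCensus.RotationOrder` / `…ScrewBlowdown`, and `rotZ_smul_vec` (tree twin in a non-importable theses-cone module) is a local `have` at its two
use sites (proof-only diffs).

No census VALUE is moved here (rows D7 / R4 keep their values; the members become TREE-decided by name); NS regularity is NOT proved; no summit
statement is proved by this file.
-/

noncomputable section

-- the summit and its single problem share the name `NavierStokesRegularity` (D-0017 nested layout)
set_option linter.dupNamespace false

open Set Function Filter Topology

namespace Summit.NavierStokesRegularity.NavierStokesRegularity.Theorems.ScenarioCensus.ScalingSpectrum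

open Literature.Analysis Literature.Analysis.FluidPDE
open Summit.NavierStokesRegularity.NavierStokesRegularity.Theorems.PoloidalWindowDoorPoloidalWindowRigidityStrata
  (eq_zero_of_scaleInvariant)
open Summit.NavierStokesRegularity.NavierStokesRegularity.Theorems.PoloidalWindowDoorPoloidalWindowRigidityOneSlice
  (eq_zero_of_translate_eq_slice)

/-! ### Second reading of the instrument: the CENTRE. DSS about two distinct centres -/

/-- `u` is **discretely self-similar with factor `c` about the space–time point `(0, a)`**:
`c u(c²t, a + c(x − a)) = u(t, x)` for all `t, x` (the parabolic dilation with spatial centre `a` and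
apex time `0`). For `a = 0` this is `IsDiscretelySelfSimilar c u` (`isDssAbout_zero_iff`). -/
def IsDssAbout (a : EuclideanSpace ℝ (Fin 3)) (c : ℝ)
    (u : ℝ → EuclideanSpace ℝ (Fin 3) → EuclideanSpace ℝ (Fin 3)) : Prop :=
  ∀ t x, c • u (c ^ 2 * t) (a + c • (x - a)) = u t x

/-- DSS about the origin is `IsDiscretelySelfSimilar`. -/
theorem isDssAbout_zero_iff {c : ℝ} {u : ℝ → EuclideanSpace ℝ (Fin 3) → EuclideanSpace ℝ (Fin 3)} :
    IsDssAbout 0 c u ↔ IsDiscretelySelfSimilar c u := by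
  constructor
  · intro h
    funext t x
    rw [nsRescale_apply, ← h t x, zero_add, sub_zero]
  · intro h t x
    have e := congrFun (congrFun h t) x
    rw [nsRescale_apply] at e
    rw [zero_add, sub_zero]
    exact e

/-- ROW D-2c-T («two-centre DSS»): a Type-I ancient mild field in the KNSS gauge that is discretely
self-similar about TWO DISTINCT spatial centres `a ≠ b` (same apex time; factors `c, d ∉ {0, 1}`,
`0 < c`, equal factors allowed) vanishes on the past. -/
def Row_D2cT : Prop :=
  ∀ (C : ℝ) (u : ℝ → EuclideanSpace ℝ (Fin 3) → EuclideanSpace ℝ (Fin 3))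
    (a b : EuclideanSpace ℝ (Fin 3)) (c d : ℝ),
    IsTypeIAncientMild C u → a ≠ b → 0 < c → c ≠ 1 → d ≠ 0 → d ≠ 1 →
    IsDssAbout a c u → IsDssAbout b d u → ∀ t < 0, ∀ x, u t x = 0

/-- The commutator of the two dilations is a TRANSLATION by `w = (1 − c)(1 − d)(a − b)`, and `u` is
invariant under it (all slices). -/
theorem translate_of_two_centres {u : ℝ → EuclideanSpace ℝ (Fin 3) → EuclideanSpace ℝ (Fin 3)}
    {a b : EuclideanSpace ℝ (Fin 3)} {c d : ℝ} (hc : c ≠ 0) (hd : d ≠ 0)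
    (h₁ : IsDssAbout a c u) (h₂ : IsDssAbout b d u) :
    ∀ s y, u s (y + ((1 - c) * (1 - d)) • (a - b)) = u s y := by
  -- the two composites of the dilations differ by the constant vector `w`
  have key : ∀ t x, u ((c * d) ^ 2 * t) (b + d • ((a + c • (x - a)) - b)) =
      u ((c * d) ^ 2 * t) (a + c • ((b + d • (x - b)) - a)) := by
    intro t x
    have e1 := h₁ t x
    rw [← h₂ (c ^ 2 * t) (a + c • (x - a))] at e1
    have e2 := h₂ t x
    rw [← h₁ (d ^ 2 * t) (b + d • (x - b))] at e2
    rw [smul_smul] at e1 e2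
    have e3 : (c * d) • u (d ^ 2 * (c ^ 2 * t)) (b + d • (a + c • (x - a) - b)) =
        (d * c) • u (c ^ 2 * (d ^ 2 * t)) (a + c • (b + d • (x - b) - a)) := e1.trans e2.symm
    have ht1 : d ^ 2 * (c ^ 2 * t) = (c * d) ^ 2 * t := by ring
    have ht2 : c ^ 2 * (d ^ 2 * t) = (c * d) ^ 2 * t := by ring
    rw [ht1, ht2, mul_comm d c] at e3
    exact smul_right_injective _ (mul_ne_zero hc hd) e3
  intro s y
  -- solve `(c d)² t = s` and `b + d • ((a + c • (x - a)) - b) = y`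
  set t : ℝ := s / (c * d) ^ 2 with ht
  set x : EuclideanSpace ℝ (Fin 3) := a + c⁻¹ • ((b + d⁻¹ • (y - b)) - a) with hx
  have hcd : (c * d) ^ 2 ≠ 0 := pow_ne_zero 2 (mul_ne_zero hc hd)
  have hts : (c * d) ^ 2 * t = s := by rw [ht]; field_simp
  have hxy : b + d • ((a + c • (x - a)) - b) = y := by
    rw [hx, add_sub_cancel_left, smul_smul, mul_inv_cancel₀ hc, one_smul, add_sub_cancel,
      add_sub_cancel_left, smul_smul, mul_inv_cancel₀ hd, one_smul, add_sub_cancel]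
  have hxw : a + c • ((b + d • (x - b)) - a) = y + ((1 - c) * (1 - d)) • (a - b) := by
    rw [← hxy]
    module
  have k := key t x
  rw [hts, hxy, hxw] at k
  exact k.symm

/-- Conjugating a translation symmetry by the dilation about `a` rescales the period by `c` and by
`c⁻¹`. -/
theorem translate_smul_of_dssAbout {u : ℝ → EuclideanSpace ℝ (Fin 3) → EuclideanSpace ℝ (Fin 3)}
    {a : EuclideanSpace ℝ (Fin 3)} {c : ℝ} (hc : c ≠ 0) (h₁ : IsDssAbout a c u)
    {p : EuclideanSpace ℝ (Fin 3)} (hp : ∀ s y, u s (y + p) = u s y) :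
    (∀ s y, u s (y + c • p) = u s y) ∧ (∀ s y, u s (y + c⁻¹ • p) = u s y) := by
  constructor
  · intro s y
    -- write `(s, y) = (c² t, a + c • (x - a))`
    set t : ℝ := s / c ^ 2 with ht
    set x : EuclideanSpace ℝ (Fin 3) := a + c⁻¹ • (y - a) with hx
    have hts : c ^ 2 * t = s := by rw [ht]; field_simp
    have hxy : a + c • (x - a) = y := by
      rw [hx, add_sub_cancel_left, smul_smul, mul_inv_cancel₀ hc, one_smul, add_sub_cancel]
    have hxp : a + c • ((x + p) - a) = y + c • p := by rw [← hxy]; module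
    have e1 := h₁ t (x + p)
    have e2 := h₁ t x
    rw [hp t x] at e1
    rw [hxp, hts] at e1
    rw [hxy, hts] at e2
    exact smul_right_injective _ hc (e1.trans e2.symm)
  · intro s y
    have e1 := h₁ s (y + c⁻¹ • p)
    have e2 := h₁ s y
    have hxp : a + c • ((y + c⁻¹ • p) - a) = (a + c • (y - a)) + p := by
      rw [show a + c • ((y + c⁻¹ • p) - a) = a + c • (y - a) + (c * c⁻¹) • p by module,
        mul_inv_cancel₀ hc, one_smul]
    rw [hxp, hp] at e1
    exact e1.symm.trans e2

/-- The **period group along `p`**: `{r | u(s, y + r p) = u(s, y) ∀ s, y}`, an additive subgroup of `ℝ`. -/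
def periodGroup (u : ℝ → EuclideanSpace ℝ (Fin 3) → EuclideanSpace ℝ (Fin 3))
    (p : EuclideanSpace ℝ (Fin 3)) : AddSubgroup ℝ where
  carrier := {r | ∀ s y, u s (y + r • p) = u s y}
  zero_mem' := by intro s y; rw [zero_smul, add_zero]
  add_mem' := by
    intro r₁ r₂ h₁ h₂ s y
    rw [add_smul, ← add_assoc, h₂ s (y + r₁ • p), h₁ s y]
  neg_mem' := by
    intro r h s y
    have e := h s (y + (-r) • p)
    rw [add_assoc, ← add_smul, neg_add_cancel, zero_smul, add_zero] at e
    exact e.symm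

/-- Under a dilation symmetry with factor `c ∉ {0, 1}`, `0 < c`, a period group containing `1` is NOT
cyclic (it is stable under `r ↦ c r` and `r ↦ c⁻¹ r`, and no lattice `gℤ ∋ 1` is), hence dense. -/
theorem dense_periodGroup {u : ℝ → EuclideanSpace ℝ (Fin 3) → EuclideanSpace ℝ (Fin 3)}
    {a p : EuclideanSpace ℝ (Fin 3)} {c : ℝ} (hc : 0 < c) (hc1 : c ≠ 1) (h₁ : IsDssAbout a c u)
    (hp : ∀ s y, u s (y + p) = u s y) : Dense (periodGroup u p : Set ℝ) := by
  refine dense_of_not_cyclic fun g hG => ?_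
  have h1 : (1 : ℝ) ∈ periodGroup u p := by intro s y; rw [one_smul]; exact hp s y
  -- stability under multiplication by `c` and `c⁻¹`
  have hmul : ∀ r ∈ periodGroup u p, c * r ∈ periodGroup u p := by
    intro r hr s y
    have := (translate_smul_of_dssAbout hc.ne' h₁ (p := r • p) hr).1 s y
    rwa [smul_smul] at this
  have hinv : ∀ r ∈ periodGroup u p, c⁻¹ * r ∈ periodGroup u p := by
    intro r hr s y
    have := (translate_smul_of_dssAbout hc.ne' h₁ (p := r • p) hr).2 s y
    rwa [smul_smul] at this
  have hg : g ∈ periodGroup u p := by rw [hG]; exact AddSubgroup.mem_zmultiples g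
  have hg0 : g ≠ 0 := by
    intro h0
    rw [hG, h0] at h1
    obtain ⟨k, hk⟩ := AddSubgroup.mem_zmultiples_iff.1 h1
    simp at hk
  have hcg := hmul g hg
  have hig := hinv g hg
  rw [hG] at hcg hig
  obtain ⟨m, hm⟩ := AddSubgroup.mem_zmultiples_iff.1 hcg
  obtain ⟨n, hn⟩ := AddSubgroup.mem_zmultiples_iff.1 hig
  rw [zsmul_eq_mul] at hm hn
  have hcm : c = m := mul_right_cancel₀ hg0 hm.symm
  have hcn : c⁻¹ = n := mul_right_cancel₀ hg0 hn.symm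
  -- `c` and `c⁻¹` are positive integers with product `1`, so `c = 1`
  have hm1 : (1 : ℝ) ≤ m := by
    have : (0 : ℤ) < m := by exact_mod_cast (hcm ▸ hc : (0 : ℝ) < m)
    exact_mod_cast this
  have hn1 : (1 : ℝ) ≤ n := by
    have hn0 : (0 : ℝ) < n := hcn ▸ inv_pos.2 hc
    have : (0 : ℤ) < n := by exact_mod_cast hn0
    exact_mod_cast this
  have hprod : (m : ℝ) * n = 1 := by rw [← hcm, ← hcn, mul_inv_cancel₀ hc.ne']
  have hm_le : (m : ℝ) ≤ 1 := by nlinarith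
  have hceq : c = 1 := by rw [hcm]; linarith
  exact hc1 hceq

/-- A dense period group and a continuous slice give invariance under the whole line `ℝ p`. -/
theorem translate_line_of_dense {u : ℝ → EuclideanSpace ℝ (Fin 3) → EuclideanSpace ℝ (Fin 3)}
    {p : EuclideanSpace ℝ (Fin 3)} (hD : Dense (periodGroup u p : Set ℝ)) {s : ℝ}
    (hcont : Continuous (u s)) : ∀ (y : EuclideanSpace ℝ (Fin 3)) (l : ℝ), u s (y + l • p) = u s y := by
  intro y l
  have hΦ : Continuous fun r : ℝ => u s (y + r • p) := by fun_prop
  have hclosed : IsClosed {r : ℝ | u s (y + r • p) = u s y} := isClosed_eq hΦ continuous_const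
  have hsub : (periodGroup u p : Set ℝ) ⊆ {r : ℝ | u s (y + r • p) = u s y} := fun r hr => hr s y
  have hall := hclosed.closure_subset_iff.2 hsub
  rw [hD.closure_eq] at hall
  exact hall (mem_univ l)

/-- **ROW D-2c-T holds** («a Type-I profile has at most one scaling centre»). -/
theorem row_D2cT_holds : Row_D2cT := by
  intro C u a b c d hu hab hc hc1 hd hd1 h₁ h₂ t ht x
  set w : EuclideanSpace ℝ (Fin 3) := ((1 - c) * (1 - d)) • (a - b) with hw
  have hw0 : w ≠ 0 := by
    rw [hw]
    exact smul_ne_zero (mul_ne_zero (sub_ne_zero.2 (Ne.symm hc1)) (sub_ne_zero.2 (Ne.symm hd1)))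
      (sub_ne_zero.2 hab)
  have hT : ∀ s y, u s (y + w) = u s y := translate_of_two_centres hc.ne' hd h₁ h₂
  have hD : Dense (periodGroup u w : Set ℝ) := dense_periodGroup hc hc1 h₁ hT
  have hline : ∀ (y : EuclideanSpace ℝ (Fin 3)) (l : ℝ), u (-1) (y + l • w) = u (-1) y :=
    translate_line_of_dense hD (hu.continuous_slice (by norm_num))
  exact eq_zero_of_translate_eq_slice hu.hasTypeITimeDecay hu.continuousOn_uncurry
    (fun s t hst ht x => hu.mild_eq_heatExtension hst ht x) (fun t ht => hu.isDivFree ht)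
    (by norm_num : (-1 : ℝ) < 0) hw0 hline t ht x

/-- **SYMMETRY PORTRAIT** (display): a NON-TRIVIAL Type-I ancient mild field has (i) a lattice factor
spectrum `(log λ₀)ℤ` and (ii) at most one scaling centre. -/
theorem atMostOneCentre_of_nontrivial {C : ℝ}
    {u : ℝ → EuclideanSpace ℝ (Fin 3) → EuclideanSpace ℝ (Fin 3)} (hu : IsTypeIAncientMild C u)
    (hne : ∃ t < 0, ∃ x, u t x ≠ 0) {a b : EuclideanSpace ℝ (Fin 3)} {c d : ℝ}
    (hc : 0 < c) (hc1 : c ≠ 1) (hd : d ≠ 0) (hd1 : d ≠ 1)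
    (h₁ : IsDssAbout a c u) (h₂ : IsDssAbout b d u) : a = b := by
  by_contra hab
  obtain ⟨t, ht, x, hx⟩ := hne
  exact hx (row_D2cT_holds C u a b c d hu hab hc hc1 hd hd1 h₁ h₂ t ht x)

end Summit.NavierStokesRegularity.NavierStokesRegularity.Theorems.ScenarioCensus.ScalingSpectrum

end
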